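import Literature.NumberTheory.EllipticCurves.Rank1Residual.Typed.X5DescentAnyLevel
import HarnessLib

/-!
# X5 (p = 2): the descent datum from a Cassels–Tate value at ANY SPLIT of the level

Support file for the BSD rank-≤ 1 residual programme, class X5 (`p = 2`); cell `bsd-2adic`, seat
`bsd-2adic-ss-1` (GEN 15), item stmt-BirchSwinnertonDyer-19097 (`SupersingularRankZeroAtTwo`) AT its
per-class residue. Honest framing: prove what is provable now; no claim beyond stated classes.
Everything here is proved; the named facts entering the consumers are Gross–Zagier–Kolyvagin
(`hGZK`) and, for the lower-bound form, the orthogonality property of the Cassels–Tate pairing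
(supplied as the hypothesis `horth`, cf. `sha_orthogonal_two_of_casselsTate`). Nothing is claimed
for any curve.

`X5DescentAnyLevel` states the mechanism with ONE pairing bit at the level `(2^(k+1), 2)`: a
non-zero value `B x y` with `x ∈ Ш[2^(k+1)]`, `y ∈ Ш[2]`. Bilinearity alone moves powers of `2`
between the two arguments INSIDE the lifting range `Ш[2^k] ⊆ 2Ш`, so the SAME datum is carried by a
non-zero value at ANY split `(2^m, 2^n)` of the level, `m + n = k + 2`, `n ≥ 1`:

* `exists_two_pow_smul_eq_of_two_divisible` — inside the lifting range an element of `A[2^m]` is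
  `2^i` times an element of `A[2^(m+i))]` (`m + i ≤ k + 1`);
* `pairing_bit_of_split_bit` — a non-zero `B x y` on `A[2^m] × A[2^n]` (`m + n = k + 2`) gives a
  non-zero value on `A[2^(k+1)] × A[2]`; hence `stable_two_pow_of_split_bit`:
  `A[2^(k+2)] = A[2^(k+1)]` (structure-free: `B` is ANY alternating bi-additive map);
* `forall_pairing_eq_zero_of_split_vanishing`, `two_divisible_succ_of_split_vanishing` — the
  LOWER-BOUND direction: if `B` VANISHES on `A[2^m] × A[2^n]` (`m + n = k + 2`, `m, n ≥ 1`) then it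
  vanishes on `A[2^(k+1)] × A[2]`, so with the orthogonality property (the Cassels–Tate kernel)
  the lifting line climbs one level, `A[2^(k+1)] ⊆ 2A`, and `#A[2^(k+2)] = 4^(k+2)`;
* `X5.descentCertificateAt_of_split_bit`, `X5.bsdp_two_of_split_bit` — the X5 consumers, and the
  level-`3` specialisation `X5.bsdp_two_of_pairing_bit₄₄`: for a curve with `#Ш[2] = 4`,
  `Ш[4] ⊆ 2Ш` and `ord₂ #Ш_an = 6`, ONE non-zero value of an alternating pairing on `Ш[4] × Ш[4]`
  is `BSD(E, 2)` (granted GZK) — the same closure as a bit at `(8, 2)`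
  (`X5.bsdp_two_of_pairing_bit₈`), but read on `4`-coverings only;
* `X5.two_pow_dvd_shaOrder_of_split_vanishing` — vanishing on `Ш[2^m] × Ш[2^n]` + orthogonality
  gives `2^(2(k+2)) ∣ #Ш` (junk-safe: `#Ш = 0` if `Ш` is infinite); at `k = 2`, `m = n = 2`:
  vanishing on `Ш[4] × Ш[4]` gives `2^8 ∣ #Ш` (`X5.two_pow_eight_dvd_shaOrder_of_vanishing₄₄`), and
  `X5.missingLowerBoundAt_two_of_split_vanishing` is the Miller lower half it carries.

WHY (the per-class residue of crux 19097 after CERT-K2-CT42): the `K = 2` X5 classes are decided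
by the level-`2` datum; the `K ≥ 3` classes need a value at total level `4`. In print and in the
lane the only level-`4` instrument contemplated is `(8, 2)` (an `8`-covering paired with a
`2`-covering — no engine). These lemmas record that `(4, 4)` — two `4`-coverings, which the lane's
engine F already produces — carries exactly the same information: ONE non-zero value closes a
`K = 3` class, identically-zero values give the `2^8` lower bound of a `K = 4` class. Whether a
`(4, 4)` evaluation is practical is an engineering question this file does not touch.

References: Silverman, *AEC* (2009), Thm. X.4.2, Thm. X.4.14; Cassels (1962), Arithmetic IV,
Thm. 1.1; Cassels (1998), §1; Miller (2011), Def. 1.1.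
-/

noncomputable section

open scoped Classical
open scoped AddSubgroup

open WeierstrassCurve Literature.NumberTheory.EllipticCurves
  Literature.NumberTheory.EllipticCurves.Rank1Residual
  Literature.GroupTheory.FiniteAbelian

namespace Literature.NumberTheory.EllipticCurves.Rank1Residual.Typed

/-! ### §1 Algebra: moving powers of `2` across the pairing inside the lifting range -/

section Algebra

variable {A : Type*} [AddCommGroup A] {Q : Type*} [AddCommGroup Q] (B : A →+ A →+ Q)

omit B in
/-- `2^(a + d) • x = 2^d • (2^a • x)` (content-free private helper). [folklore] -/
private theorem two_pow_add_smul (a d : ℕ) (x : A) : 2 ^ (a + d) • x = 2 ^ d • (2 ^ a • x) := by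
  rw [smul_smul, ← pow_add, add_comm]

omit B in
/-- `2^b • x = 0` from `2^a • x = 0` and `a ≤ b` (content-free private helper). [folklore] -/
private theorem two_pow_smul_eq_zero_of_le {a b : ℕ} (hab : a ≤ b) {x : A} (hx : 2 ^ a • x = 0) :
    2 ^ b • x = 0 := by
  obtain ⟨d, rfl⟩ := Nat.exists_eq_add_of_le hab
  rw [two_pow_add_smul, hx, smul_zero]

omit B in
/-- **Iterated halving inside the lifting range.** If every element of `A[2^k]` is twice an element
(`hdiv`), then for `m + i ≤ k + 1` every `x ∈ A[2^m]` is `2^i • x'` for some `x' ∈ A[2^(m+i)]`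
(induction on `i`: as long as `m + i ≤ k` the current `x_i ∈ A[2^(m+i)] ⊆ A[2^k]` halves again).
[cite: SilvermanAEC2009, Thm. X.4.14 (only the group structure is used)] -/
theorem exists_two_pow_smul_eq_of_two_divisible {k : ℕ}
    (hdiv : ∀ y : A, 2 ^ k • y = 0 → ∃ x : A, 2 • x = y) :
    ∀ (i m : ℕ), m + i ≤ k + 1 → ∀ x : A, 2 ^ m • x = 0 →
      ∃ x' : A, 2 ^ i • x' = x ∧ 2 ^ (m + i) • x' = 0 := by
  intro i
  induction i with
  | zero =>
    intro m _ x hx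
    exact ⟨x, by rw [pow_zero, one_smul], by rw [add_zero]; exact hx⟩
  | succ i ih =>
    intro m hmi x hx
    obtain ⟨xi, hxi, hxi0⟩ := ih m (by omega) x hx
    -- `x_i ∈ A[2^(m+i)] ⊆ A[2^k]` since `m + i ≤ k`
    have hk : 2 ^ k • xi = 0 := two_pow_smul_eq_zero_of_le (by omega) hxi0
    obtain ⟨x', hx'⟩ := hdiv xi hk
    refine ⟨x', ?_, ?_⟩
    · rw [pow_succ, ← smul_smul, hx', hxi]
    · rw [show m + (i + 1) = (m + i) + 1 from by omega, pow_succ, ← smul_smul, hx', hxi0]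

/-- **A non-zero value at a SPLIT level gives the `(2^(k+1), 2)` bit.** If `A[2^k] ⊆ 2A` (`hdiv`)
and `m + n = k + 2` with `n ≥ 1`, a non-zero `B x y` with `x ∈ A[2^m]`, `y ∈ A[2^n]` gives a non-zero
`B x' y'` with `x' ∈ A[2^(k+1)]`, `y' ∈ A[2]`: write `x = 2^(n-1) • x'` inside the lifting range
(`exists_two_pow_smul_eq_of_two_divisible`, `m + (n-1) = k + 1`) and move the power across,
`B x y = B (2^(n-1) • x') y = B x' (2^(n-1) • y)`. Bilinearity only — `B` is ANY bi-additive map.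
[cite: SilvermanAEC2009, Thm. X.4.14 (bilinear)] [cite: Cassels1998, §1] -/
theorem pairing_bit_of_split_bit {k m n : ℕ} (hmn : m + n = k + 2) (hn : 1 ≤ n)
    (hdiv : ∀ y : A, 2 ^ k • y = 0 → ∃ x : A, 2 • x = y)
    (hbit : ∃ x y : A, 2 ^ m • x = 0 ∧ 2 ^ n • y = 0 ∧ B x y ≠ 0) :
    ∃ x y : A, 2 ^ (k + 1) • x = 0 ∧ 2 • y = 0 ∧ B x y ≠ 0 := by
  obtain ⟨x, y, hx, hy, hB⟩ := hbit
  obtain ⟨i, rfl⟩ : ∃ i, n = i + 1 := ⟨n - 1, by omega⟩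
  have hmi : m + i = k + 1 := by omega
  obtain ⟨x', hx', hx'0⟩ :=
    exists_two_pow_smul_eq_of_two_divisible hdiv i m (by omega) x hx
  refine ⟨x', 2 ^ i • y, by rw [← hmi]; exact hx'0, ?_, ?_⟩
  · rw [smul_smul, ← pow_succ', hy]
  · have e : B x' (2 ^ i • y) = B (2 ^ i • x') y := by
      simp only [map_nsmul, AddMonoidHom.nsmul_apply]
    rw [e, hx']
    exact hB

/-- **ONE non-zero value at ANY split `(2^m, 2^n)` of the level, `m + n = k + 2`, IS
`A[2^(k+2)] = A[2^(k+1)]`**, structure-free (for ANY alternating bi-additive `B` on `A` with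
`#A[2] = 4` and `A[2^k] ⊆ 2A`): `pairing_bit_of_split_bit` ∘ `stable_two_pow_of_pairing_bit`.
Levels of interest: `k = 2`, `(m, n) = (3, 1)` is the `(8, 2)` bit of `X5DescentLevel3Witness`;
`(m, n) = (2, 2)` is a non-zero Cassels–Tate value on `Ш[4] × Ш[4]`.
[cite: SilvermanAEC2009, Thm. X.4.14 (bilinear, alternating)] [cite: Cassels1998, §1] -/
theorem stable_two_pow_of_split_bit {k m n : ℕ} (hmn : m + n = k + 2) (hn : 1 ≤ n)
    (halt : ∀ x : A, B x x = 0) (hcard : Nat.card (A[(2 : ℕ)]) = 4)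
    (hdiv : ∀ y : A, 2 ^ k • y = 0 → ∃ x : A, 2 • x = y)
    (hbit : ∃ x y : A, 2 ^ m • x = 0 ∧ 2 ^ n • y = 0 ∧ B x y ≠ 0) :
    ∀ z : A, 2 ^ (k + 2) • z = 0 → 2 ^ (k + 1) • z = 0 :=
  stable_two_pow_of_pairing_bit B halt hcard hdiv (pairing_bit_of_split_bit B hmn hn hdiv hbit)

/-- **Vanishing at a split level gives vanishing at `(2^(k+1), 2)`** (the lower-bound direction,
bilinearity only): if `A[2^k] ⊆ 2A` (`hdiv`), `m + n = k + 2` with `m, n ≥ 1`, and `B` vanishes on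
`A[2^m] × A[2^n]`, then `B` vanishes on `A[2^(k+1)] × A[2]`: for `x ∈ A[2^(k+1)]`, `y ∈ A[2]` write
`y = 2^(n-1) • y'` with `y' ∈ A[2^n]` (inside the lifting range, `1 + (n-1) ≤ k + 1` as `m ≥ 1`), so
`B x y = B (2^(n-1) • x) y'` with `2^(n-1) • x ∈ A[2^m]`. [cite: SilvermanAEC2009, Thm. X.4.14 (bilinear)] -/
theorem forall_pairing_eq_zero_of_split_vanishing {k m n : ℕ} (hmn : m + n = k + 2) (hm : 1 ≤ m)
    (hn : 1 ≤ n) (hdiv : ∀ y : A, 2 ^ k • y = 0 → ∃ x : A, 2 • x = y)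
    (hvan : ∀ x y : A, 2 ^ m • x = 0 → 2 ^ n • y = 0 → B x y = 0) :
    ∀ x y : A, 2 ^ (k + 1) • x = 0 → 2 • y = 0 → B x y = 0 := by
  intro x y hx hy
  obtain ⟨i, rfl⟩ : ∃ i, n = i + 1 := ⟨n - 1, by omega⟩
  have hmi : m + i = k + 1 := by omega
  have hy1 : 2 ^ 1 • y = 0 := by rw [pow_one]; exact hy
  obtain ⟨y', hy', hy'0⟩ :=
    exists_two_pow_smul_eq_of_two_divisible hdiv i 1 (by omega) y hy1
  -- `2^i • x ∈ A[2^m]`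
  have hxm : 2 ^ m • (2 ^ i • x) = 0 := by
    rw [smul_smul, ← pow_add, hmi, hx]
  have e : B x (2 ^ i • y') = B (2 ^ i • x) y' := by
    simp only [map_nsmul, AddMonoidHom.nsmul_apply]
  rw [← hy', e]
  exact hvan _ _ hxm (by rw [add_comm] at hy'0; exact hy'0)

/-- **The lifting line climbs one level from split vanishing + orthogonality.** If `A[2^k] ⊆ 2A`,
`B` vanishes on `A[2^m] × A[2^n]` (`m + n = k + 2`, `m, n ≥ 1`) and `B` has the ORTHOGONALITY
property (`horth`: an element pairing trivially with `A[2]` is twice an element — the Cassels–Tate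
kernel property on a finite `Ш`), then `A[2^(k+1)] ⊆ 2A`. At `k = 2`, `(m, n) = (2, 2)`: an
identically-zero pairing on `Ш[4] × Ш[4]` gives `Ш[8] ⊆ 2Ш`.
[cite: SilvermanAEC2009, Thm. X.4.14] [cite: Cassels1962ArithmeticIV, Thm. 1.1] -/
theorem two_divisible_succ_of_split_vanishing {k m n : ℕ} (hmn : m + n = k + 2) (hm : 1 ≤ m)
    (hn : 1 ≤ n) (horth : ∀ x : A, (∀ y : A, 2 • y = 0 → B x y = 0) → ∃ w : A, 2 • w = x)
    (hdiv : ∀ y : A, 2 ^ k • y = 0 → ∃ x : A, 2 • x = y)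
    (hvan : ∀ x y : A, 2 ^ m • x = 0 → 2 ^ n • y = 0 → B x y = 0) :
    ∀ y : A, 2 ^ (k + 1) • y = 0 → ∃ x : A, 2 • x = y :=
  fun y hy => horth y fun z hz =>
    forall_pairing_eq_zero_of_split_vanishing B hmn hm hn hdiv hvan y z hy hz

/-- **The count one level up from split vanishing**: `#A[2] = 4`, `A[2^k] ⊆ 2A`, `B` orthogonal and
vanishing on `A[2^m] × A[2^n]` (`m + n = k + 2`, `m, n ≥ 1`) ⟹ `#A[2^(k+2)] = 4^(k+2)`.
[cite: SilvermanAEC2009, Thm. X.4.14] [cite: MerrimanSiksekSmart1996, §4] -/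
theorem card_torsionBy_two_pow_of_split_vanishing {k m n : ℕ} (hmn : m + n = k + 2) (hm : 1 ≤ m)
    (hn : 1 ≤ n) (horth : ∀ x : A, (∀ y : A, 2 • y = 0 → B x y = 0) → ∃ w : A, 2 • w = x)
    (hcard : Nat.card (A[(2 : ℕ)]) = 4)
    (hdiv : ∀ y : A, 2 ^ k • y = 0 → ∃ x : A, 2 • x = y)
    (hvan : ∀ x y : A, 2 ^ m • x = 0 → 2 ^ n • y = 0 → B x y = 0) :
    Nat.card (A[(2 ^ (k + 2) : ℕ)]) = 4 ^ (k + 2) :=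
  card_torsionBy_two_pow_of_two_divisible (k := k + 1) hcard
    (two_divisible_succ_of_split_vanishing B hmn hm hn horth hdiv hvan)

end Algebra

/-! ### §2 `Ш(E/ℚ)`: the X5 consumers at a split level -/

section Sha

variable (W : WeierstrassCurve ℚ) [W.IsElliptic] [W.IsGloballyMinimal]

omit [W.IsElliptic] [W.IsGloballyMinimal] in
/-- **The X5 descent datum from ONE non-zero value at a split level.** For a curve with `#Ш[2] = 4`:
the lifting line `Ш[2^k] ⊆ 2Ш`, ANY alternating bi-additive `B` on `Ш(E/ℚ)` with ONE non-zero value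
on `Ш[2^m] × Ш[2^n]` (`m + n = k + 2`, `n ≥ 1`) and `ord₂ #Ш_an = 2(k+1)` give
`X5.DescentCertificateAt W` (level `k + 1`). Nothing is claimed for any curve.
[cite: SilvermanAEC2009, Thm. X.4.2(a), Thm. X.4.14] [cite: Cassels1998, §1] [cite: Miller2011LMS, Def. 1.1] -/
theorem X5.descentCertificateAt_of_split_bit {k m n : ℕ} (hmn : m + n = k + 2) (hn : 1 ≤ n)
    {Q : Type*} [AddCommGroup Q] (B : W.sha →+ W.sha →+ Q) (halt : ∀ x : W.sha, B x x = 0)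
    (h2 : Nat.card (AddSubgroup.torsionBy W.sha 2) = 4)
    (hdiv : ∀ y : W.sha, 2 ^ k • y = 0 → ∃ x : W.sha, 2 • x = y)
    (hbit : ∃ x y : W.sha, 2 ^ m • x = 0 ∧ 2 ^ n • y = 0 ∧ B x y ≠ 0)
    {q : ℚ} (hq : shaAn W = (q : ℂ)) (hv : padicValRat 2 q = ((2 * (k + 1) : ℕ) : ℤ)) :
    X5.DescentCertificateAt W :=
  X5.descentCertificateAt_of_pairing_bit W B halt h2 hdiv (pairing_bit_of_split_bit B hmn hn hdiv hbit)
    hq hv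

/-- **X5, ANY split of ANY level: `BSD(E, 2)` from ONE non-zero value** (granted GZK `hGZK`;
`r_an ≤ 1`; `#Ш[2] = 4`; `Ш[2^k] ⊆ 2Ш`; ANY alternating bi-additive `B` on `Ш(E/ℚ)` with a non-zero
value on `Ш[2^m] × Ш[2^n]`, `m + n = k + 2`, `n ≥ 1`; `ord₂ #Ш_an = 2(k+1)`). Nothing is claimed for
any curve. [cite: SilvermanAEC2009, Thm. X.4.2(a), Thm. X.4.14] [cite: Cassels1998, §1] [cite: Miller2011LMS, Def. 1.1] -/
theorem X5.bsdp_two_of_split_bit {k m n : ℕ} (hmn : m + n = k + 2) (hn : 1 ≤ n)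
    (hGZK : rank_eq_analyticRank_of_analyticRank_le_one) (hr : W.analyticRank ≤ 1)
    {Q : Type*} [AddCommGroup Q] (B : W.sha →+ W.sha →+ Q) (halt : ∀ x : W.sha, B x x = 0)
    (h2 : Nat.card (AddSubgroup.torsionBy W.sha 2) = 4)
    (hdiv : ∀ y : W.sha, 2 ^ k • y = 0 → ∃ x : W.sha, 2 • x = y)
    (hbit : ∃ x y : W.sha, 2 ^ m • x = 0 ∧ 2 ^ n • y = 0 ∧ B x y ≠ 0)
    {q : ℚ} (hq : shaAn W = (q : ℂ)) (hv : padicValRat 2 q = ((2 * (k + 1) : ℕ) : ℤ)) :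
    BSDp W 2 :=
  X5.bsdp_two_of_pairing_bit W hGZK hr B halt h2 hdiv (pairing_bit_of_split_bit B hmn hn hdiv hbit)
    hq hv

/-- **X5, level 3 read on `4`-coverings only: `BSD(E, 2)` from ONE non-zero value on `Ш[4] × Ш[4]`**
(granted GZK `hGZK`; `r_an ≤ 1`; `#Ш[2] = 4`; `Ш[4] ⊆ 2Ш` — the certified `(4, 2)` vanishing —; ANY
alternating bi-additive `B` on `Ш(E/ℚ)` with `B x y ≠ 0` for some `x, y ∈ Ш[4]`; `ord₂ #Ш_an = 6`).
The `K = 3` rows of the X5 census (good-ordinary, good-supersingular, multiplicative, additive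
alike); the `(8, 2)` form of the same closure is `X5.bsdp_two_of_pairing_bit₈`. Nothing is claimed for
any curve. [cite: SilvermanAEC2009, Thm. X.4.2(a), Thm. X.4.14] [cite: Cassels1998, §1] [cite: Miller2011LMS, Def. 1.1] -/
theorem X5.bsdp_two_of_pairing_bit₄₄ (hGZK : rank_eq_analyticRank_of_analyticRank_le_one)
    (hr : W.analyticRank ≤ 1) {Q : Type*} [AddCommGroup Q] (B : W.sha →+ W.sha →+ Q)
    (halt : ∀ x : W.sha, B x x = 0) (h2 : Nat.card (AddSubgroup.torsionBy W.sha 2) = 4)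
    (hdiv : ∀ y : W.sha, 4 • y = 0 → ∃ x : W.sha, 2 • x = y)
    (hbit : ∃ x y : W.sha, 4 • x = 0 ∧ 4 • y = 0 ∧ B x y ≠ 0)
    {q : ℚ} (hq : shaAn W = (q : ℂ)) (hv : padicValRat 2 q = 6) : BSDp W 2 := by
  have hdiv' : ∀ y : W.sha, 2 ^ 2 • y = 0 → ∃ x : W.sha, 2 • x = y := fun y hy =>
    hdiv y (by norm_num at hy; exact hy)
  have hbit' : ∃ x y : W.sha, 2 ^ 2 • x = 0 ∧ 2 ^ 2 • y = 0 ∧ B x y ≠ 0 := by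
    obtain ⟨x, y, hx, hy, hB⟩ := hbit
    exact ⟨x, y, by norm_num; exact hx, by norm_num; exact hy, hB⟩
  exact X5.bsdp_two_of_split_bit W (k := 2) (m := 2) (n := 2) rfl (by norm_num) hGZK hr B halt h2
    hdiv' hbit' hq (by rw [hv]; norm_num)

omit [W.IsElliptic] [W.IsGloballyMinimal] in
/-- **The LOWER bound from split vanishing: `2^(2(k+2)) ∣ #Ш(E/ℚ)`.** `#Ш[2] = 4`, `Ш[2^k] ⊆ 2Ш`, an
alternating... (alternation is not even needed) bi-additive `B` on `Ш(E/ℚ)` with the ORTHOGONALITY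
property (the Cassels–Tate kernel, `sha_orthogonal_two_of_casselsTate`) that VANISHES on
`Ш[2^m] × Ш[2^n]` (`m + n = k + 2`, `m, n ≥ 1`) ⟹ `#Ш[2^(k+2)] = 4^(k+2)` divides `#Ш` (Lagrange;
junk-safe: `W.shaOrder = 0` if `Ш` is infinite). Nothing is claimed for any curve.
[cite: SilvermanAEC2009, Thm. X.4.14] [cite: Cassels1962ArithmeticIV, Thm. 1.1] -/
theorem X5.two_pow_dvd_shaOrder_of_split_vanishing {k m n : ℕ} (hmn : m + n = k + 2) (hm : 1 ≤ m)
    (hn : 1 ≤ n) {Q : Type*} [AddCommGroup Q] (B : W.sha →+ W.sha →+ Q)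
    (horth : ∀ x : W.sha, (∀ y : W.sha, 2 • y = 0 → B x y = 0) → ∃ w : W.sha, 2 • w = x)
    (h2 : Nat.card (AddSubgroup.torsionBy W.sha 2) = 4)
    (hdiv : ∀ y : W.sha, 2 ^ k • y = 0 → ∃ x : W.sha, 2 • x = y)
    (hvan : ∀ x y : W.sha, 2 ^ m • x = 0 → 2 ^ n • y = 0 → B x y = 0) :
    2 ^ (2 * (k + 2)) ∣ W.shaOrder := by
  have h2' : Nat.card ((W.sha)[(2 : ℕ)]) = 4 := by simpa using h2
  have hcard : Nat.card ((W.sha)[(2 ^ (k + 2) : ℕ)]) = 2 ^ (2 * (k + 2)) := by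
    rw [card_torsionBy_two_pow_of_split_vanishing B hmn hm hn horth h2' hdiv hvan, pow_mul]
    norm_num
  rw [WeierstrassCurve.shaOrder, ← hcard]
  exact AddSubgroup.card_addSubgroup_dvd_card _

omit [W.IsElliptic] [W.IsGloballyMinimal] in
/-- **Level `(4, 4)`, the `K = 4` rows' wanted lower bound: `2^8 ∣ #Ш(E/ℚ)`** from `#Ш[2] = 4`,
`Ш[4] ⊆ 2Ш` and a bi-additive `B` on `Ш(E/ℚ)` with the orthogonality property vanishing IDENTICALLY
on `Ш[4] × Ш[4]` (then `Ш[8] ⊆ 2Ш` and `#Ш[16] = 2^8`). Nothing is claimed for any curve.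
[cite: SilvermanAEC2009, Thm. X.4.14] [cite: Cassels1962ArithmeticIV, Thm. 1.1] -/
theorem X5.two_pow_eight_dvd_shaOrder_of_vanishing₄₄ {Q : Type*} [AddCommGroup Q]
    (B : W.sha →+ W.sha →+ Q)
    (horth : ∀ x : W.sha, (∀ y : W.sha, 2 • y = 0 → B x y = 0) → ∃ w : W.sha, 2 • w = x)
    (h2 : Nat.card (AddSubgroup.torsionBy W.sha 2) = 4)
    (hdiv : ∀ y : W.sha, 4 • y = 0 → ∃ x : W.sha, 2 • x = y)
    (hvan : ∀ x y : W.sha, 4 • x = 0 → 4 • y = 0 → B x y = 0) : 2 ^ 8 ∣ W.shaOrder := by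
  have hdiv' : ∀ y : W.sha, 2 ^ 2 • y = 0 → ∃ x : W.sha, 2 • x = y := fun y hy =>
    hdiv y (by norm_num at hy; exact hy)
  have hvan' : ∀ x y : W.sha, 2 ^ 2 • x = 0 → 2 ^ 2 • y = 0 → B x y = 0 := fun x y hx hy =>
    hvan x y (by norm_num at hx; exact hx) (by norm_num at hy; exact hy)
  simpa using X5.two_pow_dvd_shaOrder_of_split_vanishing W (k := 2) (m := 2) (n := 2) rfl
    (by norm_num) (by norm_num) B horth h2 hdiv' hvan'

omit [W.IsElliptic] [W.IsGloballyMinimal] in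
/-- **Miller's LOWER half from split vanishing** (`Ш` finite): `#Ш[2] = 4`, `Ш[2^k] ⊆ 2Ш`, a
bi-additive `B` with the orthogonality property vanishing on `Ш[2^m] × Ш[2^n]` (`m + n = k + 2`,
`m, n ≥ 1`) and `#Ш_an = q` with `ord₂ q ≤ 2(k+2)` ⟹ `MissingLowerBoundAt W 2`. Nothing is claimed
for any curve. [cite: SilvermanAEC2009, Thm. X.4.14] [cite: Cassels1962ArithmeticIV, Thm. 1.1] [cite: Miller2011LMS, Def. 1.1] -/
theorem X5.missingLowerBoundAt_two_of_split_vanishing (hfin : W.ShaFinite) {k m n : ℕ}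
    (hmn : m + n = k + 2) (hm : 1 ≤ m) (hn : 1 ≤ n) {Q : Type*} [AddCommGroup Q]
    (B : W.sha →+ W.sha →+ Q)
    (horth : ∀ x : W.sha, (∀ y : W.sha, 2 • y = 0 → B x y = 0) → ∃ w : W.sha, 2 • w = x)
    (h2 : Nat.card (AddSubgroup.torsionBy W.sha 2) = 4)
    (hdiv : ∀ y : W.sha, 2 ^ k • y = 0 → ∃ x : W.sha, 2 • x = y)
    (hvan : ∀ x y : W.sha, 2 ^ m • x = 0 → 2 ^ n • y = 0 → B x y = 0)
    {q : ℚ} (hq : shaAn W = (q : ℂ)) (hv : padicValRat 2 q ≤ ((2 * (k + 2) : ℕ) : ℤ)) :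
    MissingLowerBoundAt W 2 := by
  haveI : Fact (Nat.Prime 2) := ⟨Nat.prime_two⟩
  refine ⟨q, hq, hv.trans ?_⟩
  have hpos : W.shaOrder ≠ 0 := (WeierstrassCurve.shaOrder_pos W hfin).ne'
  have hdvd := X5.two_pow_dvd_shaOrder_of_split_vanishing W hmn hm hn B horth h2 hdiv hvan
  exact_mod_cast (padicValNat_dvd_iff_le hpos).1 hdvd

end Sha

/-! ### §3 ONE value at `(4, 4)` decides: `K = 3` versus `K ≥ 4`

On a `#A[2] = 4` group, two elements `x, y ∈ A[4]` whose doubles are DISTINCT non-zero elements of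
`A[2]` (two `4`-coverings above two distinct non-zero `2`-Selmer classes) GENERATE `A[4]`; so an
alternating pairing on `A[4] × A[4]` is determined by the single value `B x y`. Hence ONE
evaluation at `(4, 4)` decides the level: `B x y ≠ 0` closes a `K = 3` row
(`X5.bsdp_two_of_pairing_bit₄₄`), `B x y = 0` (with orthogonality and the lifting line
`A[4] ⊆ 2A`) gives `A[8] ⊆ 2A` and `2^8 ∣ #Ш` — the `K = 4` rows' wanted lower bound. -/

section OneValue

variable {A : Type*} [AddCommGroup A] {Q : Type*} [AddCommGroup Q] (B : A →+ A →+ Q)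

omit B in
/-- In a `2`-torsion group with exactly four elements, two distinct non-zero elements `a, b` and
`a + b` exhaust the non-zero elements. Private copy of the private helper `torsionBy_two_cases` of
`X5DescentPairing` (finite case analysis). [folklore] -/
private theorem torsionBy_two_cases_of_card_four (hcard : Nat.card (A[(2 : ℕ)]) = 4) {a b : A}
    (ha : 2 • a = 0) (hb : 2 • b = 0) (ha0 : a ≠ 0) (hb0 : b ≠ 0) (hab : a ≠ b) :
    ∀ v : A, 2 • v = 0 → v = 0 ∨ v = a ∨ v = b ∨ v = a + b := by
  intro v hv
  haveI : Finite (A[(2 : ℕ)]) := Nat.finite_of_card_ne_zero (by rw [hcard]; norm_num)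
  haveI : Fintype (A[(2 : ℕ)]) := Fintype.ofFinite _
  have hmem : ∀ {x : A}, 2 • x = 0 → x ∈ A[(2 : ℕ)] := fun hx => AddSubgroup.torsionBy.nsmul_iff.2 hx
  let a' : A[(2 : ℕ)] := ⟨a, hmem ha⟩
  let b' : A[(2 : ℕ)] := ⟨b, hmem hb⟩
  let v' : A[(2 : ℕ)] := ⟨v, hmem hv⟩
  have hab' : a' + b' = ⟨a + b, hmem (by rw [smul_add, ha, hb, add_zero])⟩ := rfl
  -- `a + b` is a fourth element
  have hnegb : -b = b := by
    rw [neg_eq_iff_add_eq_zero, ← two_nsmul]; exact hb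
  have h1 : a + b ≠ 0 := by
    intro h; apply hab; rw [add_eq_zero_iff_eq_neg.1 h, hnegb]
  have h2 : a + b ≠ a := by
    intro h; exact hb0 (by simpa using h)
  have h3 : a + b ≠ b := by
    intro h; exact ha0 (by simpa using h)
  -- the four-element finset is all of `A[2]`
  let S : Finset (A[(2 : ℕ)]) := {0, a', b', a' + b'}
  have hS : S.card = 4 := by
    have e0a : (0 : A[(2 : ℕ)]) ≠ a' := fun h => ha0 (congrArg Subtype.val h).symm
    have e0b : (0 : A[(2 : ℕ)]) ≠ b' := fun h => hb0 (congrArg Subtype.val h).symm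
    have e0c : (0 : A[(2 : ℕ)]) ≠ a' + b' := fun h =>
      h1 (by rw [hab'] at h; exact (congrArg Subtype.val h).symm)
    have eab : a' ≠ b' := fun h => hab (congrArg Subtype.val h)
    have eac : a' ≠ a' + b' := fun h =>
      h2 (by rw [hab'] at h; exact (congrArg Subtype.val h).symm)
    have ebc : b' ≠ a' + b' := fun h =>
      h3 (by rw [hab'] at h; exact (congrArg Subtype.val h).symm)
    simp only [S]
    rw [Finset.card_insert_of_notMem, Finset.card_insert_of_notMem, Finset.card_insert_of_notMem,
      Finset.card_singleton]
    · simpa using ebc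
    · simp only [Finset.mem_insert, Finset.mem_singleton, not_or]; exact ⟨eab, eac⟩
    · simp only [Finset.mem_insert, Finset.mem_singleton, not_or]; exact ⟨e0a, e0b, e0c⟩
  have hcard' : Fintype.card (A[(2 : ℕ)]) = 4 := by rw [← Nat.card_eq_fintype_card, hcard]
  have hSuniv : S = Finset.univ := Finset.eq_univ_of_card S (by rw [hS, hcard'])
  have hvS : v' ∈ S := by rw [hSuniv]; exact Finset.mem_univ _
  simp only [S, Finset.mem_insert, Finset.mem_singleton] at hvS
  rcases hvS with h | h | h | h
  · left; simpa [v'] using congrArg Subtype.val h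
  · right; left; simpa [v', a'] using congrArg Subtype.val h
  · right; right; left; simpa [v', b'] using congrArg Subtype.val h
  · right; right; right; rw [hab'] at h; simpa [v'] using congrArg Subtype.val h

omit B in
/-- `4 • z = 2 • (2 • z)` (content-free private helper). [folklore] -/
private theorem four_smul_eq (z : A) : 4 • z = 2 • (2 • z) := by
  rw [smul_smul]; rfl

omit B in
/-- **Two elements of `A[4]` with distinct non-zero doubles generate `A[4]`** (on a `#A[2] = 4`
group): every `u ∈ A[4]` is `a • x + b • y` with `a, b ∈ ℕ`. First `A[2] = {0, 2x, 2y, 2x + 2y}`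
(`torsionBy_two_cases_of_card_four`), then `2u ∈ A[2]` places `u` in `x`-`y`-translates of `A[2]`.
In the lane's language: the `4`-coverings above two distinct non-zero `2`-Selmer classes generate
`Ш[4]` (torsion rank `t = 0`, `#Ш[2] = 4`). [cite: SilvermanAEC2009, Thm. X.4.14 (only the group structure is used)] -/
theorem exists_nsmul_add_nsmul_of_torsionBy_four (hcard : Nat.card (A[(2 : ℕ)]) = 4) {x y : A}
    (hx : 4 • x = 0) (hy : 4 • y = 0) (h2x : 2 • x ≠ 0) (h2y : 2 • y ≠ 0)
    (hxy : 2 • x ≠ 2 • y) : ∀ u : A, 4 • u = 0 → ∃ a b : ℕ, u = a • x + b • y := by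
  have h22x : 2 • (2 • x) = 0 := by rw [← four_smul_eq]; exact hx
  have h22y : 2 • (2 • y) = 0 := by rw [← four_smul_eq]; exact hy
  have cases₂ := torsionBy_two_cases_of_card_four hcard h22x h22y h2x h2y hxy
  -- step 1: the elements of `A[2]`
  have step₁ : ∀ w : A, 2 • w = 0 → ∃ a b : ℕ, w = a • x + b • y := by
    intro w hw
    rcases cases₂ w hw with h | h | h | h
    · exact ⟨0, 0, by rw [h, zero_smul, zero_smul, add_zero]⟩
    · exact ⟨2, 0, by rw [h, zero_smul, add_zero]⟩
    · exact ⟨0, 2, by rw [h, zero_smul, zero_add]⟩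
    · exact ⟨2, 2, by rw [h]⟩
  -- step 2: `2u ∈ A[2]`
  intro u hu
  have h2u : 2 • (2 • u) = 0 := by rw [← four_smul_eq]; exact hu
  rcases cases₂ (2 • u) h2u with h | h | h | h
  · exact step₁ u h
  · obtain ⟨a, b, hab⟩ := step₁ (u - x) (by rw [smul_sub, h, sub_self])
    exact ⟨a + 1, b, by rw [add_smul, one_smul, add_right_comm, ← hab, sub_add_cancel]⟩
  · obtain ⟨a, b, hab⟩ := step₁ (u - y) (by rw [smul_sub, h, sub_self])
    exact ⟨a, b + 1, by rw [add_smul, one_smul, ← add_assoc, ← hab, sub_add_cancel]⟩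
  · obtain ⟨a, b, hab⟩ := step₁ (u - (x + y)) (by rw [smul_sub, smul_add, h, sub_self])
    refine ⟨a + 1, b + 1, ?_⟩
    have e : (a + 1) • x + (b + 1) • y = (a • x + b • y) + (x + y) := by
      rw [add_smul, add_smul, one_smul, one_smul]; abel
    rw [e, ← hab, sub_add_cancel]

/-- **ONE zero value at `(4, 4)` is identically zero.** For an ALTERNATING bi-additive `B` on a
`#A[2] = 4` group and `x, y ∈ A[4]` with distinct non-zero doubles: `B x y = 0` ⟹ `B` vanishes on
`A[4] × A[4]` (generation by `x, y`; `B x x = B y y = 0`, `B y x = -B x y`).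
[cite: SilvermanAEC2009, Thm. X.4.14 (bilinear, alternating)] -/
theorem forall_pairing_torsionBy_four_eq_zero_of_value_eq_zero (halt : ∀ z : A, B z z = 0)
    (hcard : Nat.card (A[(2 : ℕ)]) = 4) {x y : A} (hx : 4 • x = 0) (hy : 4 • y = 0)
    (h2x : 2 • x ≠ 0) (h2y : 2 • y ≠ 0) (hxy : 2 • x ≠ 2 • y) (hB : B x y = 0) :
    ∀ u v : A, 4 • u = 0 → 4 • v = 0 → B u v = 0 := by
  have hskew : B y x = 0 := by
    have h := halt (x + y)
    rw [B.map_add, AddMonoidHom.add_apply, map_add, map_add, halt, halt, hB] at h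
    simpa using h
  have gen := exists_nsmul_add_nsmul_of_torsionBy_four hcard hx hy h2x h2y hxy
  intro u v hu hv
  obtain ⟨a, b, rfl⟩ := gen u hu
  obtain ⟨c, d, rfl⟩ := gen v hv
  simp only [map_add, map_nsmul, AddMonoidHom.add_apply, AddMonoidHom.nsmul_apply, halt, hB, hskew,
    smul_zero, add_zero]

/-- **ONE non-zero value at `(4, 4)` from ANY pair of generators.** Conversely, if `B` does not
vanish on `A[4] × A[4]` then `B x y ≠ 0` for EVERY `x, y ∈ A[4]` with distinct non-zero doubles —
so the engine may evaluate on whichever two `4`-coverings it holds. [cite: SilvermanAEC2009, Thm. X.4.14] -/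
theorem pairing_value_ne_zero_of_exists (halt : ∀ z : A, B z z = 0)
    (hcard : Nat.card (A[(2 : ℕ)]) = 4) {x y : A} (hx : 4 • x = 0) (hy : 4 • y = 0)
    (h2x : 2 • x ≠ 0) (h2y : 2 • y ≠ 0) (hxy : 2 • x ≠ 2 • y)
    (hex : ∃ u v : A, 4 • u = 0 ∧ 4 • v = 0 ∧ B u v ≠ 0) : B x y ≠ 0 := by
  obtain ⟨u, v, hu, hv, huv⟩ := hex
  exact fun h =>
    huv (forall_pairing_torsionBy_four_eq_zero_of_value_eq_zero B halt hcard hx hy h2x h2y hxy h u v hu hv)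

end OneValue

section ShaOneValue

variable (W : WeierstrassCurve ℚ) [W.IsElliptic] [W.IsGloballyMinimal]

omit [W.IsElliptic] [W.IsGloballyMinimal] in
/-- **`K = 4` rows: `2^8 ∣ #Ш(E/ℚ)` from ONE zero Cassels–Tate value at `(4, 4)`.** `#Ш[2] = 4`,
the lifting line `Ш[4] ⊆ 2Ш` (the certified `(4, 2)` vanishing), an ALTERNATING bi-additive `B` on
`Ш(E/ℚ)` with the orthogonality property (the Cassels–Tate kernel, `sha_orthogonal_two_of_casselsTate`),
and ONE value `B x y = 0` on `x, y ∈ Ш[4]` with distinct non-zero doubles (two `4`-coverings above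
distinct non-zero `2`-Selmer classes) ⟹ `B ≡ 0` on `Ш[4] × Ш[4]` ⟹ `Ш[8] ⊆ 2Ш` ⟹
`#Ш[16] = 2^8 ∣ #Ш` (junk-safe). Nothing is claimed for any curve.
[cite: SilvermanAEC2009, Thm. X.4.14] [cite: Cassels1962ArithmeticIV, Thm. 1.1] -/
theorem X5.two_pow_eight_dvd_shaOrder_of_value₄₄_eq_zero {Q : Type*} [AddCommGroup Q]
    (B : W.sha →+ W.sha →+ Q) (halt : ∀ z : W.sha, B z z = 0)
    (horth : ∀ x : W.sha, (∀ y : W.sha, 2 • y = 0 → B x y = 0) → ∃ w : W.sha, 2 • w = x)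
    (h2 : Nat.card (AddSubgroup.torsionBy W.sha 2) = 4)
    (hdiv : ∀ y : W.sha, 4 • y = 0 → ∃ x : W.sha, 2 • x = y)
    {x y : W.sha} (hx : 4 • x = 0) (hy : 4 • y = 0) (h2x : 2 • x ≠ 0) (h2y : 2 • y ≠ 0)
    (hxy : 2 • x ≠ 2 • y) (hB : B x y = 0) : 2 ^ 8 ∣ W.shaOrder := by
  have h2' : Nat.card ((W.sha)[(2 : ℕ)]) = 4 := by simpa using h2
  exact X5.two_pow_eight_dvd_shaOrder_of_vanishing₄₄ W B horth h2 hdiv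
    (forall_pairing_torsionBy_four_eq_zero_of_value_eq_zero B halt h2' hx hy h2x h2y hxy hB)

/-- **`K = 3` rows: `BSD(E, 2)` from ONE non-zero Cassels–Tate value at `(4, 4)`** on ANY two
`4`-coverings — restatement of `X5.bsdp_two_of_pairing_bit₄₄` with the witness pair explicit
(granted GZK; `r_an ≤ 1`; `#Ш[2] = 4`; `Ш[4] ⊆ 2Ш`; `B x y ≠ 0` for some `x, y ∈ Ш[4]`;
`ord₂ #Ш_an = 6`). Together with `X5.two_pow_eight_dvd_shaOrder_of_value₄₄_eq_zero`: ONE evaluation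
at `(4, 4)` per class decides `K = 3` (closure) versus `K ≥ 4` (`2^8 ∣ #Ш`). Nothing is claimed for
any curve. [cite: SilvermanAEC2009, Thm. X.4.2(a), Thm. X.4.14] [cite: Cassels1998, §1] [cite: Miller2011LMS, Def. 1.1] -/
theorem X5.bsdp_two_of_value₄₄_ne_zero (hGZK : rank_eq_analyticRank_of_analyticRank_le_one)
    (hr : W.analyticRank ≤ 1) {Q : Type*} [AddCommGroup Q] (B : W.sha →+ W.sha →+ Q)
    (halt : ∀ z : W.sha, B z z = 0) (h2 : Nat.card (AddSubgroup.torsionBy W.sha 2) = 4)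
    (hdiv : ∀ y : W.sha, 4 • y = 0 → ∃ x : W.sha, 2 • x = y)
    {x y : W.sha} (hx : 4 • x = 0) (hy : 4 • y = 0) (hB : B x y ≠ 0)
    {q : ℚ} (hq : shaAn W = (q : ℂ)) (hv : padicValRat 2 q = 6) : BSDp W 2 :=
  X5.bsdp_two_of_pairing_bit₄₄ W hGZK hr B halt h2 hdiv ⟨x, y, hx, hy, hB⟩ hq hv

end ShaOneValue

end Literature.NumberTheory.EllipticCurves.Rank1Residual.Typed

end
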